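import Literature.Topology.FourManifolds.NearIdentityIsotopy
import Literature.Topology.FourManifolds.PosDetStraightenable
import Literature.Topology.FourManifolds.DiffeotopyTransport
import HarnessLib

/-!
# Compact straightening of linear maps by diffeomorphisms diffeotopic to the identity

Topic `Literature/Topology/FourManifolds` (fact seat
`provefact-Literature.Topology.FourManifolds.IsHandlebody.exists_isBoundaryGluing_sphere`, step F2b of
the Lickorish–Wallace DAG; second layer of the *isotopy-tracked* disc theorem).  Everything here
is **proved**; no named facts.

`CompactlySupportedDiffeo.lean` / `PosDetStraightenable.lean` prove that every linear
automorphism of `ℝⁿ` of positive determinant is *compactly straightenable*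
(`Literature.Topology.FourManifolds.IsStraightenable`: agrees near `0` with a compactly supported
diffeomorphism), the constructive content of "`GL⁺(n)` is connected" in Hirsch's proof of the disc
theorem (*Differential Topology* (1976), Ch. 8 §3, Thm. 3.1).  Hirsch's proof uses more: the
straightening diffeomorphisms are **isotopic to the identity** through compactly supported
diffeomorphisms, which is what makes the resulting diffeomorphism of the ambient manifold
diffeotopic to the identity (and hence extendable across collars).  This file records that
refinement:

* `Literature.Topology.FourManifolds.IsStraightenableIso X` — `X` agrees near `0` with a
  diffeomorphism `s` of `E`, the identity off a ball `B̄(0, R)`, which is the time-`1` stage of a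
  diffeotopy of `E` all of whose stages are the identity off `B̄(0, R)`;
* the closure properties of `IsStraightenable` hold verbatim (`id`, `comp`, `mul`, `pow`, `conj`,
  rescaling, near-identity maps via `NearIdentityIsotopy.lean`, the root trick, homotheties,
  transvections, positive diagonal maps), with the same proofs plus bookkeeping of the
  diffeotopies (`Diffeotopy.trans`, `Diffeotopy.pushforward`);
* `Literature.Topology.FourManifolds.isStraightenableIso_of_det_pos` — every `L ∈ GL⁺(ℝⁿ)` is
  straightenable by a diffeomorphism compactly diffeotopic to the identity (same Gaussian
  elimination as `isStraightenable_of_det_pos`).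

## References

* M. W. Hirsch, *Differential Topology*, GTM 33 (1976), Ch. 8 §1 (p. 178) and §3, proof of
  Thm. 3.1. [HirschDT1976]
-/

open scoped Manifold ContDiff Topology
open Set Function Filter Metric

noncomputable section

namespace Literature.Topology.FourManifolds

/-! ### The notion and its closure properties -/

section Straightenable

variable {E : Type*} [NormedAddCommGroup E] [NormedSpace ℝ E]

/-- A continuous linear map `X : E → E` is **compactly straightenable by a diffeomorphism
compactly diffeotopic to the identity** if it agrees near `0` with a diffeomorphism `s` of `E`
which is the identity off some ball `B̄(0, R)` and is the time-`1` stage of a diffeotopy of `E`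
all of whose stages are the identity off `B̄(0, R)` (Hirsch 1976, Ch. 8 §3, proof of Thm. 3.1:
the straightening diffeomorphisms are isotopic to the identity). [cite: HirschDT1976, Ch. 8 §3, proof of Thm. 3.1] -/
def IsStraightenableIso (X : E →L[ℝ] E) : Prop :=
  ∃ (s : E ≃ₘ⟮𝓘(ℝ, E), 𝓘(ℝ, E)⟯ E) (ρ R : ℝ), 0 < ρ ∧
    (∀ y, ‖y‖ ≤ ρ → s y = X y) ∧ (∀ y, R ≤ ‖y‖ → s y = y) ∧
    ∃ D : Diffeotopy 𝓘(ℝ, E) E, D.stage 1 = s ∧ ∀ t y, R ≤ ‖y‖ → D.toFun t y = y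

namespace IsStraightenableIso

/-- Forgetting the diffeotopy. [folklore] -/
theorem isStraightenable {X : E →L[ℝ] E} (hX : IsStraightenableIso X) : IsStraightenable X := by
  obtain ⟨s, ρ, R, hρ, hs1, hs2, -⟩ := hX
  exact ⟨s, ρ, R, hρ, hs1, hs2⟩

/-- The identity is straightenable (constant diffeotopy). [folklore] -/
theorem id : IsStraightenableIso (ContinuousLinearMap.id ℝ E) :=
  ⟨Diffeomorph.refl _ E _, 1, 0, one_pos, fun _ _ ↦ rfl, fun _ _ ↦ rfl, Diffeotopy.refl _ _,
    Diffeomorph.ext fun _ => rfl, fun _ _ _ => rfl⟩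

/-- `1 = id` is straightenable. [folklore] -/
theorem one : IsStraightenableIso (1 : E →L[ℝ] E) := by
  rw [ContinuousLinearMap.one_def]; exact .id

/-- Closure under composition (compose the diffeomorphisms and the diffeotopies stagewise).
[folklore] -/
theorem comp {X Y : E →L[ℝ] E} (hX : IsStraightenableIso X) (hY : IsStraightenableIso Y) :
    IsStraightenableIso (X.comp Y) := by
  obtain ⟨s, ρ, R, hρ, hs1, hs2, D, hD1, hD2⟩ := hX
  obtain ⟨t, ρ', R', hρ', ht1, ht2, D', hD1', hD2'⟩ := hY
  refine ⟨t.trans s, min ρ' (ρ / (‖Y‖ + 1)), max R R', by positivity, fun y hy ↦ ?_,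
    fun y hy ↦ ?_, D'.trans D, Diffeomorph.ext fun y => ?_, fun τ y hy => ?_⟩
  · simp only [Diffeomorph.coe_trans, ContinuousLinearMap.coe_comp, Function.comp_apply]
    rw [ht1 y (hy.trans (min_le_left _ _)), hs1]
    calc ‖Y y‖ ≤ ‖Y‖ * ‖y‖ := Y.le_opNorm y
      _ ≤ ‖Y‖ * (ρ / (‖Y‖ + 1)) := by gcongr; exact hy.trans (min_le_right _ _)
      _ ≤ (‖Y‖ + 1) * (ρ / (‖Y‖ + 1)) := by gcongr; linarith
      _ = ρ := by field_simp
  · simp only [Diffeomorph.coe_trans, Function.comp_apply]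
    rw [ht2 y ((le_max_right _ _).trans hy), hs2 y ((le_max_left _ _).trans hy)]
  · rw [Diffeotopy.coe_stage, Diffeotopy.trans_toFun, Diffeomorph.coe_trans, Function.comp_apply, Function.comp_apply,
      ← Diffeotopy.coe_stage, ← Diffeotopy.coe_stage, hD1, hD1']
  · rw [Diffeotopy.trans_toFun, Function.comp_apply, hD2' τ y ((le_max_right _ _).trans hy),
      hD2 τ y ((le_max_left _ _).trans hy)]

/-- Closure under products (= composition). [folklore] -/
theorem mul {X Y : E →L[ℝ] E} (hX : IsStraightenableIso X) (hY : IsStraightenableIso Y) :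
    IsStraightenableIso (X * Y) :=
  hX.comp hY

/-- Closure under powers. [folklore] -/
theorem pow {X : E →L[ℝ] E} (hX : IsStraightenableIso X) (m : ℕ) : IsStraightenableIso (X ^ m) := by
  induction m with
  | zero => rw [pow_zero]; exact .one
  | succ m ih => rw [pow_succ]; exact ih.mul hX

/-- A bound used twice: if `s = id` off `B̄(0, R)` then `S ∘ s ∘ S⁻¹ = id` off
`B̄(0, (‖S‖ + 1)|R|)`. [folklore] -/
theorem norm_symm_apply_ge (S : E ≃L[ℝ] E) {R : ℝ} {y : E}
    (hy : (‖(S : E →L[ℝ] E)‖ + 1) * |R| ≤ ‖y‖) : R ≤ ‖S.symm y‖ := by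
  by_contra hlt
  push Not at hlt
  have hR : 0 < R := lt_of_le_of_lt (norm_nonneg _) hlt
  have h1 : ‖y‖ ≤ ‖(S : E →L[ℝ] E)‖ * ‖S.symm y‖ := by
    conv_lhs => rw [← S.apply_symm_apply y]
    exact (S : E →L[ℝ] E).le_opNorm _
  have h2 : ‖(S : E →L[ℝ] E)‖ * ‖S.symm y‖ < (‖(S : E →L[ℝ] E)‖ + 1) * |R| := by
    calc ‖(S : E →L[ℝ] E)‖ * ‖S.symm y‖ ≤ ‖(S : E →L[ℝ] E)‖ * R := by gcongr
      _ < (‖(S : E →L[ℝ] E)‖ + 1) * R := by nlinarith [norm_nonneg (S : E →L[ℝ] E)]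
      _ = (‖(S : E →L[ℝ] E)‖ + 1) * |R| := by rw [abs_of_pos hR]
  linarith

/-- Invariance under conjugation by continuous linear automorphisms (push the diffeotopy
forward along `S`). [folklore] -/
theorem conj {X : E →L[ℝ] E} (hX : IsStraightenableIso X) (S : E ≃L[ℝ] E) :
    IsStraightenableIso ((S : E →L[ℝ] E).comp (X.comp (S.symm : E →L[ℝ] E))) := by
  obtain ⟨s, ρ, R, hρ, hs1, hs2, D, hD1, hD2⟩ := hX
  refine ⟨(S.symm.toDiffeomorph.trans s).trans S.toDiffeomorph,
    ρ / (‖(S.symm : E →L[ℝ] E)‖ + 1), (‖(S : E →L[ℝ] E)‖ + 1) * |R|, by positivity,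
    fun y hy ↦ ?_, fun y hy ↦ ?_, D.pushforward S.toDiffeomorph, ?_, fun t y hy => ?_⟩
  · simp only [Diffeomorph.coe_trans, ContinuousLinearEquiv.coe_toDiffeomorph, Function.comp_apply,
      ContinuousLinearMap.coe_comp, ContinuousLinearEquiv.coe_coe]
    rw [hs1]
    calc ‖S.symm y‖ ≤ ‖(S.symm : E →L[ℝ] E)‖ * ‖y‖ := (S.symm : E →L[ℝ] E).le_opNorm y
      _ ≤ ‖(S.symm : E →L[ℝ] E)‖ * (ρ / (‖(S.symm : E →L[ℝ] E)‖ + 1)) := by gcongr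
      _ ≤ (‖(S.symm : E →L[ℝ] E)‖ + 1) * (ρ / (‖(S.symm : E →L[ℝ] E)‖ + 1)) := by
          gcongr; linarith
      _ = ρ := by field_simp
  · simp only [Diffeomorph.coe_trans, ContinuousLinearEquiv.coe_toDiffeomorph, Function.comp_apply]
    rw [hs2 _ (norm_symm_apply_ge S hy), ContinuousLinearEquiv.apply_symm_apply]
  · rw [Diffeotopy.pushforward_stage, hD1]
    ext y
    rfl
  · rw [Diffeotopy.pushforward_toFun]
    show S (D.toFun t (S.toDiffeomorph.symm y)) = y
    have : S.toDiffeomorph.symm y = S.symm y := rfl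
    rw [this, hD2 t _ (norm_symm_apply_ge S hy), ContinuousLinearEquiv.apply_symm_apply]

/-- Rescaling: a straightenable map agrees with such a diffeomorphism on the whole closed unit
ball (conjugate by the dilation `y ↦ ρ y`, pushing the diffeotopy forward along `y ↦ ρ⁻¹ y`).
[folklore] -/
theorem exists_eq_on_closedBall {X : E →L[ℝ] E} (hX : IsStraightenableIso X) :
    ∃ (s : E ≃ₘ⟮𝓘(ℝ, E), 𝓘(ℝ, E)⟯ E) (R : ℝ),
      (∀ y, ‖y‖ ≤ 1 → s y = X y) ∧ (∀ y, R ≤ ‖y‖ → s y = y) ∧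
      ∃ D : Diffeotopy 𝓘(ℝ, E) E, D.stage 1 = s ∧ ∀ t y, R ≤ ‖y‖ → D.toFun t y = y := by
  obtain ⟨s, ρ, R, hρ, hs1, hs2, D, hD1, hD2⟩ := hX
  -- the dilation by `ρ⁻¹` as a continuous linear automorphism (`S y = ρ⁻¹ y`, `S⁻¹ y = ρ y`)
  let S : E ≃L[ℝ] E := ContinuousLinearEquiv.equivOfInverse
    (ρ⁻¹ • ContinuousLinearMap.id ℝ E) (ρ • ContinuousLinearMap.id ℝ E)
    (fun y ↦ show ρ • ρ⁻¹ • y = y by rw [smul_smul, mul_inv_cancel₀ hρ.ne', one_smul])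
    (fun y ↦ show ρ⁻¹ • ρ • y = y by rw [smul_smul, inv_mul_cancel₀ hρ.ne', one_smul])
  have hS : ∀ y, S y = ρ⁻¹ • y := fun y ↦ rfl
  have hS' : ∀ y, S.symm y = ρ • y := fun y ↦ rfl
  have hnorm : ∀ y : E, ‖ρ • y‖ = ρ * ‖y‖ := fun y => by rw [norm_smul, Real.norm_of_nonneg hρ.le]
  have hbig : ∀ y : E, R / ρ ≤ ‖y‖ → R ≤ ‖ρ • y‖ := fun y hy => by
    rw [hnorm]; rwa [div_le_iff₀' hρ] at hy
  refine ⟨(S.symm.toDiffeomorph.trans s).trans S.toDiffeomorph, R / ρ, fun y hy ↦ ?_,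
    fun y hy ↦ ?_, D.pushforward S.toDiffeomorph, ?_, fun t y hy => ?_⟩
  · simp only [Diffeomorph.coe_trans, ContinuousLinearEquiv.coe_toDiffeomorph, Function.comp_apply, hS, hS']
    rw [hs1 _ (by rw [hnorm]; nlinarith), map_smul, smul_smul, inv_mul_cancel₀ hρ.ne', one_smul]
  · simp only [Diffeomorph.coe_trans, ContinuousLinearEquiv.coe_toDiffeomorph, Function.comp_apply, hS, hS']
    rw [hs2 _ (hbig y hy), smul_smul, inv_mul_cancel₀ hρ.ne', one_smul]
  · rw [Diffeotopy.pushforward_stage, hD1]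
    ext y
    rfl
  · rw [Diffeotopy.pushforward_toFun]
    show S (D.toFun t (S.toDiffeomorph.symm y)) = y
    have : S.toDiffeomorph.symm y = S.symm y := rfl
    rw [this, hS', hD2 t _ (hbig y hy), hS, smul_smul, inv_mul_cancel₀ hρ.ne', one_smul]

variable [FiniteDimensional ℝ E] [CompleteSpace E]

/-- Near-identity maps are straightenable by diffeomorphisms diffeotopic to the identity
(`NearIdentityIsotopy.lean`). [cite: HirschDT1976, Ch. 8 §3, proof of Thm. 3.1] -/
theorem exists_forall_norm_sub_id_le (E : Type*) [NormedAddCommGroup E] [NormedSpace ℝ E]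
    [FiniteDimensional ℝ E] [CompleteSpace E] :
    ∃ δ₀ > (0 : ℝ), ∀ X : E →L[ℝ] E, ‖X - ContinuousLinearMap.id ℝ E‖ ≤ δ₀ →
      IsStraightenableIso X := by
  obtain ⟨δ₀, hδ₀, H⟩ := exists_diffeomorph_diffeotopy_eq_of_norm_sub_id_le E
  refine ⟨δ₀, hδ₀, fun X hX ↦ ?_⟩
  obtain ⟨G, D, hG1, hG2, hD1, hD2⟩ := H X hX
  exact ⟨G, 1, 2, one_pos, fun y hy ↦ hG1 y (by simpa using hy), hG2, D, hD1, hD2⟩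

/-- Maps of a family tending to the identity are eventually straightenable. [folklore] -/
theorem eventually_of_tendsto {ι : Type*} {l : Filter ι} {X : ι → E →L[ℝ] E}
    (hX : Tendsto X l (𝓝 (ContinuousLinearMap.id ℝ E))) :
    ∀ᶠ i in l, IsStraightenableIso (X i) := by
  obtain ⟨δ₀, hδ₀, H⟩ := exists_forall_norm_sub_id_le E
  have := (Metric.tendsto_nhds.mp hX) δ₀ hδ₀
  filter_upwards [this] with i hi
  exact H _ (by rw [dist_eq_norm] at hi; exact hi.le)

/-- **Root trick.** If `X = (Y m) ^ (m + 1)` with `Y m → id`, then `X` is straightenable.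
[folklore] -/
theorem of_pow_eq_of_tendsto {X : E →L[ℝ] E} {Y : ℕ → E →L[ℝ] E}
    (hY : Tendsto Y atTop (𝓝 (ContinuousLinearMap.id ℝ E)))
    (hXY : ∀ m, Y m ^ (m + 1) = X) : IsStraightenableIso X := by
  obtain ⟨m, hm⟩ := (eventually_of_tendsto hY).exists
  rw [← hXY m]
  exact hm.pow (m + 1)

/-- Positive homotheties are straightenable. [folklore] -/
theorem smul_id {a : ℝ} (ha : 0 < a) : IsStraightenableIso (a • ContinuousLinearMap.id ℝ E) := by
  refine of_pow_eq_of_tendsto (Y := fun m : ℕ ↦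
    Real.exp (Real.log a / ((m : ℝ) + 1)) • ContinuousLinearMap.id ℝ E) ?_ fun m ↦ ?_
  · have h1 : Tendsto (fun m : ℕ ↦ Real.log a / ((m : ℝ) + 1)) atTop (𝓝 0) :=
      tendsto_const_nhds.div_atTop (tendsto_atTop_add_const_right _ 1 tendsto_natCast_atTop_atTop)
    have h2 : Tendsto (fun m : ℕ ↦ Real.exp (Real.log a / ((m : ℝ) + 1))) atTop (𝓝 1) := by
      simpa [Function.comp_def] using (Real.continuous_exp.tendsto 0).comp h1
    simpa using h2.smul_const (ContinuousLinearMap.id ℝ E)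
  · rw [smul_pow, ← ContinuousLinearMap.one_def, one_pow, ← Real.exp_nat_mul]
    congr 1
    rw [Nat.cast_add_one, mul_div_cancel₀ _ (by positivity), Real.exp_log ha]

end IsStraightenableIso

end Straightenable

/-! ### Linear automorphisms of positive determinant -/

section Pivot

open Matrix

variable {ι : Type*} [Fintype ι] [DecidableEq ι]

/-- Transvections are straightenable by diffeomorphisms diffeotopic to the identity (root
trick `τ(c) = τ(c/m)^m`, as for `isStraightenable_toEuclideanCLM_transvection`). [folklore] -/
theorem isStraightenableIso_toEuclideanCLM_transvection {i j : ι} (hij : i ≠ j) (c : ℝ) :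
    IsStraightenableIso (Matrix.toEuclideanCLM (n := ι) (𝕜 := ℝ) (transvection i j c)) := by
  refine IsStraightenableIso.of_pow_eq_of_tendsto
    (Y := fun m : ℕ ↦ Matrix.toEuclideanCLM (n := ι) (𝕜 := ℝ)
      (transvection i j (c / ((m : ℝ) + 1)))) ?_ fun m ↦ ?_
  · have h1 : Tendsto (fun m : ℕ ↦ c / ((m : ℝ) + 1)) atTop (𝓝 0) :=
      tendsto_const_nhds.div_atTop (tendsto_atTop_add_const_right _ 1 tendsto_natCast_atTop_atTop)
    have hcont : Continuous (fun d : ℝ ↦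
        Matrix.toEuclideanCLM (n := ι) (𝕜 := ℝ) (transvection i j d)) := by
      have heq : (fun d : ℝ ↦ (transvection i j d : Matrix ι ι ℝ)) =
          fun d ↦ (1 : Matrix ι ι ℝ) + d • Matrix.single i j (1 : ℝ) := by
        funext d; rw [transvection, Matrix.smul_single, smul_eq_mul, mul_one]
      have hc : Continuous (fun d : ℝ ↦ (transvection i j d : Matrix ι ι ℝ)) := by
        rw [heq]; exact continuous_const.add (continuous_id.smul continuous_const)
      exact continuous_toEuclideanCLM.comp hc
    have h3 := (hcont.tendsto 0).comp h1
    simpa [Function.comp_def, transvection_zero, ContinuousLinearMap.one_def] using h3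
  · rw [← map_pow, transvection_pow_eq hij]
    congr 2
    rw [Nat.cast_add_one, mul_div_cancel₀ _ (by positivity)]

/-- Positive diagonal maps are straightenable by diffeomorphisms diffeotopic to the identity
(root trick with `m`-th roots, as for `isStraightenable_toEuclideanCLM_diagonal`). [folklore] -/
theorem isStraightenableIso_toEuclideanCLM_diagonal {d : ι → ℝ} (hd : ∀ i, 0 < d i) :
    IsStraightenableIso (Matrix.toEuclideanCLM (n := ι) (𝕜 := ℝ) (diagonal d)) := by
  refine IsStraightenableIso.of_pow_eq_of_tendsto
    (Y := fun m : ℕ ↦ Matrix.toEuclideanCLM (n := ι) (𝕜 := ℝ)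
      (diagonal fun i ↦ d i ^ (((m + 1 : ℕ) : ℝ)⁻¹))) ?_ fun m ↦ ?_
  · have h1 : Tendsto (fun m : ℕ ↦ ((m + 1 : ℕ) : ℝ)⁻¹) atTop (𝓝 0) :=
      tendsto_inv_atTop_zero.comp (tendsto_natCast_atTop_atTop.comp (tendsto_add_atTop_nat 1))
    have h2 : Tendsto (fun m : ℕ ↦ fun i ↦ d i ^ (((m + 1 : ℕ) : ℝ)⁻¹)) atTop (𝓝 fun _ ↦ 1) := by
      rw [tendsto_pi_nhds]
      intro i
      have := ((Real.continuousAt_const_rpow (hd i).ne').tendsto).comp h1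
      simpa [Function.comp_def, Real.rpow_zero] using this
    have h3 := ((continuous_toEuclideanCLM (ι := ι)).comp
      (continuous_id.matrix_diagonal)).tendsto (fun _ ↦ (1 : ℝ)) |>.comp h2
    simpa [Function.comp_def, ContinuousLinearMap.one_def] using h3
  · rw [← map_pow, diagonal_pow]
    congr 2
    ext i
    exact Real.rpow_inv_natCast_pow (hd i).le (Nat.succ_ne_zero m)

/-- Products of transvections are straightenable by diffeomorphisms diffeotopic to the identity.
[folklore] -/
theorem isStraightenableIso_toEuclideanCLM_prod (L : List (TransvectionStruct ι ℝ)) :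
    IsStraightenableIso
      (Matrix.toEuclideanCLM (n := ι) (𝕜 := ℝ) (L.map TransvectionStruct.toMatrix).prod) := by
  induction L with
  | nil => simpa using IsStraightenableIso.one
  | cons t L ih =>
    rw [List.map_cons, List.prod_cons, map_mul]
    refine IsStraightenableIso.mul ?_ ih
    rcases t with ⟨i, j, hij, c⟩
    exact isStraightenableIso_toEuclideanCLM_transvection hij c

/-- The rotation by `π` of a coordinate plane is straightenable by a diffeomorphism diffeotopic
to the identity (square of the quarter turn, a product of transvections). [folklore] -/
theorem isStraightenableIso_toEuclideanCLM_diagonal_neg_pair {i j : ι} (hij : i ≠ j) :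
    IsStraightenableIso (Matrix.toEuclideanCLM (n := ι) (𝕜 := ℝ)
      (diagonal (fun k => if k = i ∨ k = j then (-1 : ℝ) else 1))) := by
  rw [diagonal_neg_pair_eq hij, ← transvectionQuarterTurn_sq hij, map_mul]
  have hJ : IsStraightenableIso (Matrix.toEuclideanCLM (n := ι) (𝕜 := ℝ)
      (transvectionQuarterTurn i j)) := by
    rw [transvectionQuarterTurn, map_mul, map_mul]
    exact ((isStraightenableIso_toEuclideanCLM_transvection hij 1).mul
      (isStraightenableIso_toEuclideanCLM_transvection hij.symm (-1))).mul
      (isStraightenableIso_toEuclideanCLM_transvection hij 1)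
  exact hJ.mul hJ

/-- A sign diagonal matrix with an even number of `-1`'s is straightenable by a diffeomorphism
diffeotopic to the identity (pair the `-1`'s into half turns). [folklore] -/
theorem isStraightenableIso_toEuclideanCLM_diagonal_sign_aux :
    ∀ (m : ℕ) (s : Finset ι), s.card = 2 * m →
      IsStraightenableIso (Matrix.toEuclideanCLM (n := ι) (𝕜 := ℝ)
        (diagonal fun k => if k ∈ s then (-1 : ℝ) else 1)) := by
  intro m
  induction m with
  | zero =>
    intro s hs
    have hs' : s = ∅ := Finset.card_eq_zero.mp (by simpa using hs)
    subst hs'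
    have : (diagonal fun k : ι => if k ∈ (∅ : Finset ι) then (-1 : ℝ) else 1) = 1 := by simp
    rw [this, map_one]
    exact IsStraightenableIso.one
  | succ m ih =>
    intro s hs
    have hcard : 0 < s.card := by omega
    obtain ⟨i, hi⟩ := Finset.card_pos.mp hcard
    have hcard₁ : 0 < (s.erase i).card := by rw [Finset.card_erase_of_mem hi]; omega
    obtain ⟨j, hj⟩ := Finset.card_pos.mp hcard₁
    have hji : j ≠ i := Finset.ne_of_mem_erase hj
    have hjs : j ∈ s := Finset.mem_of_mem_erase hj
    set s' := (s.erase i).erase j with hs'_def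
    have hs' : s'.card = 2 * m := by
      rw [hs'_def, Finset.card_erase_of_mem hj, Finset.card_erase_of_mem hi]
      omega
    have hsplit : (diagonal fun k : ι => if k ∈ s then (-1 : ℝ) else 1) =
        (diagonal fun k => if k ∈ s' then (-1 : ℝ) else 1) *
          diagonal (fun k => if k = i ∨ k = j then (-1 : ℝ) else 1) := by
      rw [diagonal_mul_diagonal]
      congr 1
      funext k
      by_cases hki : k = i
      · subst hki
        have : k ∉ s' := by simp [hs'_def]
        simp [hi, this]
      · by_cases hkj : k = j
        · subst hkj
          have : k ∉ s' := by simp [hs'_def]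
          simp [hjs, this]
        · have : k ∈ s' ↔ k ∈ s := by simp [hs'_def, hki, hkj]
          simp [this, hki, hkj]
    rw [hsplit, map_mul]
    exact (ih s' hs').mul (isStraightenableIso_toEuclideanCLM_diagonal_neg_pair hji.symm)

/-- **Every linear automorphism of `ℝⁿ` with positive determinant is compactly straightenable by a
diffeomorphism compactly diffeotopic to the identity** (Hirsch 1976, Ch. 8 §3, proof of Thm. 3.1:
"`GL⁺(n)` is connected", constructively: Gaussian elimination `L = P · diag(|d|) · diag(σ) · P'`
with `P, P'` products of transvections and `σ` an even number of sign changes; same proof as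
`Literature.Topology.FourManifolds.isStraightenable_of_det_pos`). [cite: HirschDT1976, Ch. 8 §3 Thm. 3.1] -/
theorem isStraightenableIso_of_det_pos (L : EuclideanSpace ℝ ι ≃L[ℝ] EuclideanSpace ℝ ι)
    (hL : 0 < LinearMap.det ((L : EuclideanSpace ℝ ι →L[ℝ] EuclideanSpace ℝ ι) :
      EuclideanSpace ℝ ι →ₗ[ℝ] EuclideanSpace ℝ ι)) :
    IsStraightenableIso (L : EuclideanSpace ℝ ι →L[ℝ] EuclideanSpace ℝ ι) := by
  set T := Matrix.toEuclideanCLM (n := ι) (𝕜 := ℝ) with hT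
  set M : Matrix ι ι ℝ := T.symm (L : EuclideanSpace ℝ ι →L[ℝ] EuclideanSpace ℝ ι) with hM
  have hTM : T M = (L : EuclideanSpace ℝ ι →L[ℝ] EuclideanSpace ℝ ι) := by simp [hM]
  obtain ⟨P, P', D, hMD⟩ := Pivot.exists_list_transvec_mul_diagonal_mul_list_transvec M
  have hdetM : M.det = LinearMap.det ((L : EuclideanSpace ℝ ι →L[ℝ] EuclideanSpace ℝ ι) :
      EuclideanSpace ℝ ι →ₗ[ℝ] EuclideanSpace ℝ ι) := by
    rw [← hTM, Matrix.coe_toEuclideanCLM_eq_toEuclideanLin, Matrix.toEuclideanLin_eq_toLin_orthonormal,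
      LinearMap.det_toLin]
  have hdetD : (∏ i, D i) = M.det := by
    rw [hMD, det_mul, det_mul, TransvectionStruct.det_toMatrix_prod,
      TransvectionStruct.det_toMatrix_prod, det_diagonal, one_mul, mul_one]
  have hprod : 0 < ∏ i, D i := by rw [hdetD, hdetM]; exact hL
  have hD : ∀ i, D i ≠ 0 := fun i hi => by
    rw [Finset.prod_eq_zero (Finset.mem_univ i) hi] at hprod
    exact lt_irrefl _ hprod
  set s : Finset ι := Finset.univ.filter (fun i => D i < 0) with hs_def
  have habs : ∀ i, |D i| * (if i ∈ s then (-1 : ℝ) else 1) = D i := fun i => by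
    by_cases h : D i < 0
    · have : i ∈ s := by simp [hs_def, h]
      rw [if_pos this, abs_of_neg h]; ring
    · have : i ∉ s := by simp [hs_def, h]
      rw [if_neg this, abs_of_nonneg (not_lt.mp h), mul_one]
  have heven : Even s.card := by
    by_contra hodd
    rw [Nat.not_even_iff_odd] at hodd
    have h1 : (∏ i, D i) = (∏ i, |D i|) * ∏ i, (if i ∈ s then (-1 : ℝ) else 1) := by
      rw [← Finset.prod_mul_distrib]
      exact Finset.prod_congr rfl fun i _ => (habs i).symm
    have h2 : (∏ i, (if i ∈ s then (-1 : ℝ) else 1)) = (-1) ^ s.card := by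
      rw [Finset.prod_ite, Finset.prod_const, Finset.prod_const_one, mul_one]
      congr 1
      simp [hs_def]
    rw [h1, h2, hodd.neg_one_pow] at hprod
    have h3 : 0 ≤ ∏ i, |D i| := Finset.prod_nonneg fun i _ => abs_nonneg _
    nlinarith
  obtain ⟨m, hm⟩ := heven
  have hdiag : diagonal D =
      diagonal (fun i => |D i|) * diagonal (fun i => if i ∈ s then (-1 : ℝ) else 1) := by
    rw [diagonal_mul_diagonal]
    congr 1
    funext i
    exact (habs i).symm
  have hkey : (L : EuclideanSpace ℝ ι →L[ℝ] EuclideanSpace ℝ ι) =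
      T (P.map TransvectionStruct.toMatrix).prod * (T (diagonal fun i => |D i|) *
        (T (diagonal fun i => if i ∈ s then (-1 : ℝ) else 1) *
          T (P'.map TransvectionStruct.toMatrix).prod)) := by
    rw [← hTM, hMD, hdiag]
    simp only [map_mul, mul_assoc]
  rw [hkey]
  exact (isStraightenableIso_toEuclideanCLM_prod P).mul
    ((isStraightenableIso_toEuclideanCLM_diagonal fun i => abs_pos.mpr (hD i)).mul
      ((isStraightenableIso_toEuclideanCLM_diagonal_sign_aux m s (by omega)).mul
        (isStraightenableIso_toEuclideanCLM_prod P')))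

end Pivot

end Literature.Topology.FourManifolds
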